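import Literature.NumberTheory.GaloisRepresentations.CyclotomicTowerBrauerKilling
import Literature.NumberTheory.GaloisRepresentations.PadicIntCdOne
import Literature.NumberTheory.GaloisRepresentations.LocalTowerCdOne
import Literature.NumberTheory.GaloisRepresentations.CohomologicalDimension
import Literature.NumberTheory.GaloisRepresentations.HilbertNinetySubgroup
import HarnessLib

/-!
# Killing classes of `H²(Gal(k̄/E), μ_p)` in the cyclotomic tower (Serre, *Cohomologie galoisienne*
# II §4.4 Prop. 13, proof — relative form)

Topic `NumberTheory/GaloisRepresentations`; namespace `Literature.NumberTheory.GaloisRepresentations`.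
Theorems only (no definition, no named fact; D-0026).  Companion of `NumberFieldCdTwoProofs.lean`
(the discharge of `fieldCdLE_two_of_numberField`), which needs, for the criterion
`groupCdLE_one_of_forall_subsingleton_two_mu_inf`, that classes of `H²(Gal(k̄/E), μ_p)` on the
SUBGROUPS `Gal(k̄/E) ≤ Γ_k` (`E/k` finite, `μ_p ⊂ E`) die on `Gal(k̄/E) ∩ κ⁻¹(p^m ℤ_p)` for the
cyclotomic `ℤ_p`-extension `κ`.  The killing lemma itself
(`exists_nsmul_split_comap_span_pow_of_forall_ne_one`, `CyclotomicTowerBrauerKilling.lean`) is stated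
for a number field `K` as a type and `ℚ/ℤ`-valued cocycles on `Γ_K`; this file transports:

* `exists_transport_galFixing` — `Θ : Γ_E ≅ Gal(k̄/E) ≤ Γ_k` together with an `E`-isomorphism
  `ι : k̄ ≃ Ē`, `ι(Θ(ρ) x) = ρ(ι x)` (Serre II §2: independence of the algebraic closure;
  `algEquivContinuousMulEquivAbsoluteGaloisGroup`, `galFixingOfAlgEquiv`), and the compatibility of the
  cyclotomic characters along `Θ`;
* `exists_forall_resSub_mu_eq_zero_of_le_layerSubgroup` — **every class of `H²(Gal(k̄/E), μ_p)` dies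
  on every closed `T ≤ Gal(k̄/E) ∩ κ⁻¹(p^m ℤ_p)` for some `m`** (`k` a number field, `p ≠ 2` or `k`
  totally complex, `Gal(k̄/E)` fixing `μ_p`): the class, a `μ_p`-valued cocycle with trivial action,
  is read through `μ_p ≅ (1/p)ℤ/ℤ` as a `p`-torsion `ℚ/ℤ`-cocycle on `Γ_E` and killed there with
  `φ = κ ∘ Θ` (non-trivial on every decomposition group by
  `exists_cyclotomicCharacter_resGal_not_mem_torsion`).

## References

* J.-P. Serre, *Cohomologie galoisienne* / *Galois Cohomology* (1997), II §4.4 Prop. 13 and Lemme 1,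
  II §3.3 Prop. 9, II §2. [SerreGaloisCohomology1997]
-/

noncomputable section

open CategoryTheory Function
open Field IntermediateField NumberField IsDedekindDomain

universe u

namespace Literature.NumberTheory.GaloisRepresentations

open _root_.TopRep _root_.ContRepresentation _root_.ContinuousCohomology DiscreteGaloisModule
open LocalWeilDatum Literature.NumberTheory.EllipticCurves

/-! ### Transport: `Γ_E ≅ Gal(k̄/E)` for a subextension `E ⊆ k̄` -/

section Transport

variable (k : Type u) [Field k] (E : IntermediateField k (AlgebraicClosure k))

/-- `k̄` is an algebraic closure of every subextension `E ⊆ k̄`. [folklore] -/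
private theorem isAlgClosure_intermediateField : IsAlgClosure E (AlgebraicClosure k) :=
  ⟨inferInstance, Algebra.IsAlgebraic.tower_top (K := k) E⟩

/-- **`Γ_E → Gal(k̄/E) ≤ Γ_k` compatibly with an `E`-isomorphism `k̄ ≃ Ē`.**  For a subextension
`E ⊆ k̄` there are a continuous bijective homomorphism `Θ : Γ_E → Gal(k̄/E)` and an `E`-isomorphism
`ι : k̄ ≃ₐ[E] Ē` with `ι(Θ(ρ) x) = ρ (ι x)` (Serre II §2: the absolute Galois group does not depend on
the algebraic closure; `algEquivContinuousMulEquivAbsoluteGaloisGroup`, `galFixingOfAlgEquiv`).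
[cite: SerreGaloisCohomology1997, II §2 (introduction), II §1.1] -/
theorem exists_transport_galFixing :
    ∃ (Θ : absoluteGaloisGroup E →* galFixing k E) (ι : AlgebraicClosure k ≃ₐ[E] AlgebraicClosure E),
      Continuous Θ ∧ Function.Bijective Θ ∧
      ∀ (ρ : absoluteGaloisGroup E) (x : AlgebraicClosure k),
        ι (((Θ ρ : galFixing k E) : absoluteGaloisGroup k) • x) = ρ • ι x := by
  haveI := isAlgClosure_intermediateField k E
  let ι : AlgebraicClosure k ≃ₐ[E] AlgebraicClosure E := IsAlgClosure.equiv E (AlgebraicClosure k) (AlgebraicClosure E)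
  let Ψ : (AlgebraicClosure k ≃ₐ[E] AlgebraicClosure k) ≃ₜ* absoluteGaloisGroup E :=
    algEquivContinuousMulEquivAbsoluteGaloisGroup E (AlgebraicClosure k)
  let Θ : absoluteGaloisGroup E →* galFixing k E := (galFixingOfAlgEquiv E).comp Ψ.symm.toMonoidHom
  have hΘcont : Continuous Θ := (continuous_galFixingOfAlgEquiv E).comp Ψ.symm.continuous
  have hΘact : ∀ (ρ : absoluteGaloisGroup E) (x : AlgebraicClosure k),
      ((Θ ρ : galFixing k E) : absoluteGaloisGroup k) • x = ι.symm (ρ • ι x) := fun ρ x => rfl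
  refine ⟨Θ, ι, hΘcont, ⟨fun ρ ρ' h => ?_, fun s => ?_⟩, fun ρ x => ?_⟩
  · -- injective
    apply FaithfulSMul.eq_of_smul_eq_smul (α := AlgebraicClosure E)
    intro y
    have h1 := congrArg (fun g : galFixing k E => (g : absoluteGaloisGroup k) • ι.symm y) h
    simp only [hΘact, AlgEquiv.apply_symm_apply] at h1
    exact ι.symm.injective h1
  · -- surjective
    obtain ⟨τ, hτ⟩ := galFixingOfAlgEquiv_surjective E s
    exact ⟨Ψ τ, by change galFixingOfAlgEquiv E (Ψ.symm (Ψ τ)) = s; rw [ContinuousMulEquiv.symm_apply_apply, hτ]⟩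
  · rw [hΘact, AlgEquiv.apply_symm_apply]

/-- **The cyclotomic character is compatible with the transport** `Θ : Γ_E → Gal(k̄/E) ≤ Γ_k`:
`χ_p^k(Θ ρ) = χ_p^E(ρ)` (both pinned down by the action on `p`-power roots of unity, `ι(Θ(ρ) ζ) = ρ(ι ζ)`;
the argument of the tree's `cyclotomicCharacter_absGaloisRestrict`). [folklore] -/
private theorem cyclotomicCharacter_transport [CharZero k] {p : ℕ} [Fact p.Prime]
    (Θ : absoluteGaloisGroup E →* galFixing k E) (ι : AlgebraicClosure k ≃ₐ[E] AlgebraicClosure E)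
    (hΘ : ∀ (ρ : absoluteGaloisGroup E) (x : AlgebraicClosure k),
      ι (((Θ ρ : galFixing k E) : absoluteGaloisGroup k) • x) = ρ • ι x)
    (ρ : absoluteGaloisGroup E) :
    GaloisRep.cyclotomicCharacter k p ((Θ ρ : galFixing k E) : absoluteGaloisGroup k) =
      GaloisRep.cyclotomicCharacter E p ρ := by
  haveI : NeZero (p : k) := NeZero.charZero
  haveI : CharZero E := charZero_of_injective_algebraMap (algebraMap k E).injective
  haveI : NeZero (p : E) := NeZero.charZero
  refine Units.ext (PadicInt.ext_of_toZModPow.mp fun n => ?_)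
  haveI : NeZero ((p : ℕ) : AlgebraicClosure k) :=
    NeZero.nat_of_injective (algebraMap k (AlgebraicClosure k)).injective
  haveI : NeZero ((p ^ n : ℕ) : AlgebraicClosure k) :=
    ⟨by rw [Nat.cast_pow]; exact pow_ne_zero _ (NeZero.ne _)⟩
  obtain ⟨ζ, hζ⟩ := HasEnoughRootsOfUnity.exists_primitiveRoot (AlgebraicClosure k) (p ^ n)
  have hζ' : IsPrimitiveRoot (ι ζ) (p ^ n) := hζ.map_of_injective ι.injective
  have h1 := GaloisRep.cyclotomicCharacter_spec k p (k := n) ((Θ ρ : galFixing k E) : absoluteGaloisGroup k) ζ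
    hζ.pow_eq_one
  have h2 := GaloisRep.cyclotomicCharacter_spec E p (k := n) ρ (ι ζ) hζ'.pow_eq_one
  have h3 := congrArg ι h1
  rw [hΘ, map_pow, h2] at h3
  have h4 := hζ'.pow_inj (ZMod.val_lt _) (ZMod.val_lt _) h3.symm
  exact ZMod.val_injective _ h4

end Transport

/-! ### Killing a class of `H²(Gal(k̄/E), μ_p)` on a layer `Gal(k̄/E k_m)` -/

section Kill

variable (k : Type) [Field k] [NumberField k] {p : ℕ} [hp : Fact p.Prime]

/-- **Every class of `H²(Gal(k̄/E), μ_p)` dies on `Gal(k̄/E) ∩ κ⁻¹(p^m ℤ_p)` for some `m`**, for `k`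
a number field with `p ≠ 2` or `k` totally complex, `κ` its cyclotomic `ℤ_p`-extension and `E/k` a
finite subextension of `k̄` whose Galois group fixes `μ_p` (Serre II §4.4 Prop. 13 with Lemme 1, II
§3.3 Prop. 9, in the tree's relative language).  The class is represented by a continuous cocycle
with values in `μ_p`, on which `Gal(k̄/E)` acts trivially; read through `μ_p ≅ (1/p)ℤ/ℤ` and
transported to `Γ_E` (`exists_transport_galFixing`) it is a locally constant `p`-torsion `ℚ/ℤ`-cocycle,
to which `exists_nsmul_split_comap_span_pow_of_forall_ne_one` applies with `φ = κ ∘ Θ` (non-trivial on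
every decomposition group: `cyclotomicCharacter_transport`,
`exists_cyclotomicCharacter_resGal_not_mem_torsion`); the resulting splitting is transported back.
[cite: SerreGaloisCohomology1997, II §4.4 Prop. 13 (with Lemme 1), II §3.3 Prop. 9] -/
theorem exists_forall_resSub_mu_eq_zero_of_le_layerSubgroup
    (hk : p ≠ 2 ∨ IsTotallyComplex k) {κ : ZpExtension k p} (hκ : κ.IsCyclotomic)
    (E : IntermediateField k (AlgebraicClosure k)) [FiniteDimensional k E]
    (hE : ∀ σ ∈ galFixing k E, ∀ ζ : rootsOfUnity p (AlgebraicClosure k),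
      σ • (ζ : (AlgebraicClosure k)ˣ) = ζ)
    (y : continuousCohomology 2 ((mu k p).restrict (subgroupIncl (galFixing k E))).toTopRep) :
    ∃ m : ℕ, ∀ (T : Subgroup (absoluteGaloisGroup k)) (hTE : T ≤ galFixing k E)
      [IsClosed (T : Set (absoluteGaloisGroup k))], T ≤ κ.layerSubgroup m → resSub (mu k p) hTE 2 y = 0 := by
  classical
  have hpp : p.Prime := hp.out
  haveI : NeZero p := ⟨hpp.ne_zero⟩
  haveI : CompactSpace (absoluteGaloisGroup k) := absoluteGaloisGroup_compactSpace k
  haveI : IsClosed ((galFixing k E : Subgroup (absoluteGaloisGroup k)) : Set (absoluteGaloisGroup k)) :=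
    isClosed_galFixing' k E
  haveI : CompactSpace (galFixing k E) := compactSpace_of_isClosed_subgroup
  haveI : NeZero ((p : ℕ) : AlgebraicClosure k) :=
    NeZero.nat_of_injective (algebraMap k (AlgebraicClosure k)).injective
  -- the number field `K = E`
  haveI : CharZero E := charZero_of_injective_algebraMap (algebraMap k E).injective
  haveI : NumberField E :=
    { to_charZero := inferInstance
      to_finiteDimensional := Module.Finite.trans k E }
  haveI : IsGalois k (AlgebraicClosure k) := {}
  -- a primitive `p`-th root of unity `ζ₀ ∈ E`
  obtain ⟨ζ₀, hζ₀⟩ := HasEnoughRootsOfUnity.exists_primitiveRoot (AlgebraicClosure k) p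
  have hζ₀unit : IsUnit ζ₀ := hζ₀.isUnit hpp.ne_zero
  have hζ₀mem : ζ₀ ∈ E := by
    have hfix : ∀ σ ∈ galFixing k E, σ • ζ₀ = ζ₀ := fun σ hσ => by
      have h := hE σ hσ ⟨hζ₀unit.unit, by
        rw [mem_rootsOfUnity]; ext; rw [Units.val_pow_eq_pow_val, IsUnit.unit_spec, hζ₀.pow_eq_one, Units.val_one]⟩
      have h' := congrArg (fun u : (AlgebraicClosure k)ˣ => (u : AlgebraicClosure k)) h
      simpa only [Units.coe_smul, IsUnit.unit_spec] using h'
    rw [← InfiniteGalois.fixedField_fixingSubgroup E, IntermediateField.mem_fixedField_iff]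
    intro g hg
    have hg' : (absoluteGaloisGroup.toAlgEquiv k).symm g ∈ galFixing k E := by
      change (absoluteGaloisGroup.toAlgEquiv k) ((absoluteGaloisGroup.toAlgEquiv k).symm g) ∈ E.fixingSubgroup
      rw [MulEquiv.apply_symm_apply]
      exact hg
    have h := hfix _ hg'
    rw [absoluteGaloisGroup.smul_def, MulEquiv.apply_symm_apply] at h
    exact h
  set ζE : E := ⟨ζ₀, hζ₀mem⟩ with hζE
  have hζEprim : IsPrimitiveRoot ζE p :=
    IsPrimitiveRoot.of_map_of_injective (f := algebraMap E (AlgebraicClosure k)) (by exact hζ₀)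
      (algebraMap E (AlgebraicClosure k)).injective
  have hKinf : p ≠ 2 ∨ ∀ w : InfinitePlace E, w.IsComplex := by
    rcases hk with h2 | hcx
    · exact Or.inl h2
    · right
      intro w
      exact InfinitePlace.IsComplex.of_comap (algebraMap k E) (hcx.isComplex _)
  -- transport `Θ : Γ_E ≅ Gal(k̄/E)`
  obtain ⟨Θ, ι, hΘcont, hΘbij, hΘ⟩ := exists_transport_galFixing k E
  haveI : CompactSpace (absoluteGaloisGroup E) := absoluteGaloisGroup_compactSpace E
  let Θh : absoluteGaloisGroup E ≃ₜ galFixing k E :=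
    Continuous.homeoOfEquivCompactToT2 (f := Equiv.ofBijective Θ hΘbij) hΘcont
  have hΘh : ∀ ρ, Θh ρ = Θ ρ := fun _ => rfl
  have hΘhsymm : ∀ s : galFixing k E, Θ (Θh.symm s) = s := fun s => by
    rw [← hΘh, Homeomorph.apply_symm_apply]
  -- the tower character `φ = κ ∘ Θ` on `Γ_E`
  let φ : absoluteGaloisGroup E →ₜ* Multiplicative ℤ_[p] :=
    { toMonoidHom := κ.toContinuousMonoidHom.toMonoidHom.comp ((galFixing k E).subtype.comp Θ)
      continuous_toFun := (map_continuous κ.toContinuousMonoidHom).comp (continuous_subtype_val.comp hΘcont) }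
  have hφ_apply : ∀ ρ, φ ρ = κ ((Θ ρ : galFixing k E) : absoluteGaloisGroup k) := fun _ => rfl
  have hφ : ∀ v : HeightOneSpectrum (𝓞 E), ∃ σ : absoluteGaloisGroup (v.adicCompletion E),
      φ (absGaloisRestrict E (v.adicCompletion E) σ) ≠ 1 := by
    intro v
    obtain ⟨σ, hσ⟩ := exists_cyclotomicCharacter_resGal_not_mem_torsion E p v
    refine ⟨σ, fun h1 => hσ ?_⟩
    have hmem : ((Θ (absGaloisRestrict E (v.adicCompletion E) σ) : galFixing k E) : absoluteGaloisGroup k) ∈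
        κ.kerSubgroup := h1
    rw [show κ.kerSubgroup = _ from hκ, Subgroup.mem_comap] at hmem
    rw [← cyclotomicCharacter_transport k E Θ ι hΘ]
    exact hmem
  -- the class as an explicit cocycle; `μ_p ≅ (1/p)ℤ/ℤ`
  obtain ⟨c, rfl⟩ := twoCocycleClass_surjective _ y
  obtain ⟨mexp, hm_add, hm_inj, hm0, hm_pow, hm_range, hm_surj⟩ :=
    exists_mulExp_of_isPrimitiveRoot hpp.pos hζ₀
  have hm0' : ∀ x, mexp x ≠ 0 := fun x => by
    obtain ⟨j, hj⟩ := hm_range x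
    rw [hj]
    exact pow_ne_zero _ (hζ₀.ne_zero hpp.ne_zero)
  have hm_sub : ∀ x x', p • x = 0 → p • x' = 0 → mexp (x - x') * mexp x' = mexp x := fun x x' hx hx' => by
    rw [← hm_add _ _ (by rw [nsmul_sub, hx, hx', sub_zero]) hx', sub_add_cancel]
  -- the logarithm `F` (inverse of `mexp` on `p`-th roots of unity)
  have hF : ∀ w : AlgebraicClosure k, ∃ x : AddCircle (1 : ℚ), p • x = 0 ∧ (w ^ p = 1 → mexp x = w) := fun w => by
    by_cases hw : w ^ p = 1
    · obtain ⟨j, -, hj⟩ := hζ₀.eq_pow_of_pow_eq_one hw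
      obtain ⟨x, hxp, hx⟩ := hm_surj j
      exact ⟨x, hxp, fun _ => by rw [hx, hj]⟩
    · exact ⟨0, smul_zero _, fun h => absurd h hw⟩
  choose F hFp hF using hF
  -- the value of `c` in `k̄` and its logarithm
  let cv : galFixing k E → galFixing k E → AlgebraicClosure k := fun s t =>
    (((MuCarrier.toAdditive (c.1 (s, t))).toMul : rootsOfUnity p (AlgebraicClosure k)) : (AlgebraicClosure k)ˣ)
  have hcv_pow : ∀ s t, cv s t ^ p = 1 := fun s t => by
    have h := ((MuCarrier.toAdditive (c.1 (s, t))).toMul : rootsOfUnity p (AlgebraicClosure k)).2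
    rw [mem_rootsOfUnity] at h
    have h' := congrArg (fun u : (AlgebraicClosure k)ˣ => (u : AlgebraicClosure k)) h
    simpa only [Units.val_pow_eq_pow_val, Units.val_one] using h'
  have hcv_lc : IsLocallyConstant (fun q : galFixing k E × galFixing k E => cv q.1 q.2) :=
    ((IsLocallyConstant.iff_continuous c.1).2 c.1.continuous).comp fun v : MuCarrier k p =>
      ((((MuCarrier.toAdditive v).toMul : rootsOfUnity p (AlgebraicClosure k)) : (AlgebraicClosure k)ˣ) :
        AlgebraicClosure k)
  -- the cocycle identity of `c`, read in `k̄` (trivial action of `Gal(k̄/E)` on `μ_p`)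
  have hc_coc : ∀ s t w : galFixing k E, cv t w * cv s (t * w) = cv (s * t) w * cv s t := by
    intro s t w
    have h := c.2 s t w
    have hact : ∀ (g : galFixing k E) (v : MuCarrier k p),
        ((mu k p).restrict (subgroupIncl (galFixing k E))).toTopRep.ρ g v = v := fun g v => by
      apply MuCarrier.toAdditive.injective
      rw [TopRep.of_ρ]
      change MuCarrier.toAdditive (((mu k p).restrict (subgroupIncl (galFixing k E))) g v) = _
      rw [ContinuousRep.restrict_apply, subgroupIncl_apply, mu_apply_apply]
      apply congrArg Additive.ofMul
      apply Subtype.ext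
      rw [absoluteGaloisGroup.coe_smul_rootsOfUnity]
      exact hE _ g.2 _
    rw [hact] at h
    have h' := congrArg (fun v : MuCarrier k p =>
      ((((MuCarrier.toAdditive v).toMul : rootsOfUnity p (AlgebraicClosure k)) : (AlgebraicClosure k)ˣ) :
        AlgebraicClosure k)) h
    simpa only [map_add, toMul_add, Subgroup.coe_mul, Units.val_mul] using h'
  -- the `ℚ/ℤ`-valued cocycle `z₀` on `Gal(k̄/E)` and `z` on `Γ_E`
  let z₀ : galFixing k E → galFixing k E → AddCircle (1 : ℚ) := fun s t => F (cv s t)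
  have hz₀p : ∀ s t, p • z₀ s t = 0 := fun s t => hFp _
  have hz₀m : ∀ s t, mexp (z₀ s t) = cv s t := fun s t => hF _ (hcv_pow s t)
  have hz₀_coc : ∀ s t w, z₀ s t + z₀ (s * t) w = z₀ t w + z₀ s (t * w) := fun s t w => by
    apply hm_inj _ _ (by rw [nsmul_add, hz₀p, hz₀p, add_zero]) (by rw [nsmul_add, hz₀p, hz₀p, add_zero])
    rw [hm_add _ _ (hz₀p _ _) (hz₀p _ _), hm_add _ _ (hz₀p _ _) (hz₀p _ _), hz₀m, hz₀m, hz₀m, hz₀m,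
      mul_comm, ← hc_coc, mul_comm]
  have hz₀_lc : IsLocallyConstant (Function.uncurry z₀) := hcv_lc.comp F
  let z : absoluteGaloisGroup E → absoluteGaloisGroup E → AddCircle (1 : ℚ) := fun ρ ρ' => z₀ (Θ ρ) (Θ ρ')
  have hz_lc : IsLocallyConstant (Function.uncurry z) :=
    hz₀_lc.comp_continuous (f := fun q : absoluteGaloisGroup E × absoluteGaloisGroup E => (Θ q.1, Θ q.2))
      ((hΘcont.comp continuous_fst).prodMk (hΘcont.comp continuous_snd))
  have hz_coc : ∀ σ τ υ, z σ τ + z (σ * τ) υ = z τ υ + z σ (τ * υ) := fun σ τ υ => by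
    simp only [z, map_mul]
    exact hz₀_coc _ _ _
  have hz_p : ∀ σ τ, p • z σ τ = 0 := fun σ τ => hz₀p _ _
  -- the killing lemma over `E`
  obtain ⟨m, β, hβ_lc, hβp, hβ⟩ :=
    exists_nsmul_split_comap_span_pow_of_forall_ne_one E hζEprim hKinf φ hφ z hz_lc hz_coc hz_p
  refine ⟨m, fun T hTE _ hTm => ?_⟩
  haveI : CompactSpace T := compactSpace_of_isClosed_subgroup
  -- `Θ⁻¹(T) ≤ V_m`
  have hmemV : ∀ t : T, Θh.symm ⟨(t : absoluteGaloisGroup k), hTE t.2⟩ ∈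
      (AddSubgroup.toSubgroup (Ideal.span {(p : ℤ_[p]) ^ m}).toAddSubgroup).comap φ.toMonoidHom := fun t => by
    rw [mem_comap_span_pow_iff, hφ_apply, hΘhsymm]
    exact ZpExtension.mem_layerSubgroup.1 (hTm t.2)
  let θ : T → (AddSubgroup.toSubgroup (Ideal.span {(p : ℤ_[p]) ^ m}).toAddSubgroup).comap φ.toMonoidHom :=
    fun t => ⟨Θh.symm ⟨(t : absoluteGaloisGroup k), hTE t.2⟩, hmemV t⟩
  have hθcont : Continuous θ :=
    (Θh.symm.continuous.comp (Continuous.subtype_mk continuous_subtype_val _)).subtype_mk _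
  have hθmul : ∀ s t : T, θ (s * t) = θ s * θ t := fun s t => by
    apply Subtype.ext
    apply hΘbij.1
    change Θ (Θh.symm _) = Θ (Θh.symm _ * Θh.symm _)
    rw [map_mul, hΘhsymm, hΘhsymm, hΘhsymm]
    rfl
  have hΘθ : ∀ t : T, ((Θ (θ t : absoluteGaloisGroup E) : galFixing k E) : absoluteGaloisGroup k) = t := fun t => by
    change ((Θ (Θh.symm _) : galFixing k E) : absoluteGaloisGroup k) = _
    rw [hΘhsymm]
  -- the splitting cochain with values in `μ_p`
  have hβunit : ∀ x, IsUnit (mexp x) := fun x => isUnit_iff_ne_zero.2 (hm0' x)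
  let bval : T → rootsOfUnity p (AlgebraicClosure k) := fun t =>
    ⟨(hβunit (β (θ t))).unit, by
      rw [mem_rootsOfUnity]; ext
      rw [Units.val_pow_eq_pow_val, IsUnit.unit_spec, hm_pow, Units.val_one]⟩
  have hbval : ∀ t, ((bval t : (AlgebraicClosure k)ˣ) : AlgebraicClosure k) = mexp (β (θ t)) := fun t =>
    IsUnit.unit_spec _
  have hbval_lc : IsLocallyConstant bval := by
    have h1 : IsLocallyConstant fun t : T => β (θ t) := hβ_lc.comp_continuous hθcont
    refine (IsLocallyConstant.iff_exists_open _).2 fun t => ?_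
    obtain ⟨U, hU, htU, hconst⟩ := (IsLocallyConstant.iff_exists_open _).1 h1 t
    refine ⟨U, hU, htU, fun t' ht' => ?_⟩
    apply Subtype.ext; apply Units.ext
    rw [hbval, hbval, hconst t' ht']
  let b : C(T, MuCarrier k p) := ⟨fun t => MuCarrier.ofRootsOfUnity (bval t), (hbval_lc.comp _).continuous⟩
  have hb : ∀ t, ((((MuCarrier.toAdditive (b t)).toMul : rootsOfUnity p (AlgebraicClosure k)) :
      (AlgebraicClosure k)ˣ) : AlgebraicClosure k) = mexp (β (θ t)) := fun t => hbval t
  -- the restricted class vanishes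
  rw [resSub, map_twoCocycleClass, twoCocycleClass_eq_zero_iff]
  refine ⟨b, fun s t => ?_⟩
  have hact : ∀ (g : T) (v : MuCarrier k p),
      ((mu k p).restrict (subgroupIncl T)).toTopRep.ρ g v = v := fun g v => by
    apply MuCarrier.toAdditive.injective
    rw [TopRep.of_ρ]
    change MuCarrier.toAdditive (((mu k p).restrict (subgroupIncl T)) g v) = _
    rw [ContinuousRep.restrict_apply, subgroupIncl_apply, mu_apply_apply]
    apply congrArg Additive.ofMul
    apply Subtype.ext
    rw [absoluteGaloisGroup.coe_smul_rootsOfUnity]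
    exact hE _ (hTE g.2) _
  rw [hact, contTwoCocycles.pullback_apply, resSubMod_hom_apply]
  -- compare in `k̄`
  apply MuCarrier.toAdditive.injective
  apply Additive.toMul.injective
  apply Subtype.ext
  apply Units.ext
  have hkey := hβ (θ s) (θ t)
  rw [← hθmul] at hkey
  have hzst : z (θ s : absoluteGaloisGroup E) (θ t : absoluteGaloisGroup E) = β (θ s) + β (θ t) - β (θ (s * t)) :=
    eq_sub_of_add_eq hkey
  have hzval : mexp (z (θ s : absoluteGaloisGroup E) (θ t : absoluteGaloisGroup E)) =
      cv (inclHom hTE s) (inclHom hTE t) := by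
    change mexp (z₀ (Θ (θ s : absoluteGaloisGroup E)) (Θ (θ t : absoluteGaloisGroup E))) = _
    rw [hz₀m]
    have hs : Θ (θ s : absoluteGaloisGroup E) = inclHom hTE s := Subtype.ext (hΘθ s)
    have ht : Θ (θ t : absoluteGaloisGroup E) = inclHom hTE t := Subtype.ext (hΘθ t)
    rw [hs, ht]
  change ((((MuCarrier.toAdditive (c.1 (inclHom hTE s, inclHom hTE t))).toMul :
      rootsOfUnity p (AlgebraicClosure k)) : (AlgebraicClosure k)ˣ) : AlgebraicClosure k) =
    ((((MuCarrier.toAdditive (b t - b (s * t) + b s)).toMul : rootsOfUnity p (AlgebraicClosure k)) :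
      (AlgebraicClosure k)ˣ) : AlgebraicClosure k)
  rw [map_add, map_sub, toMul_add, toMul_sub, Subgroup.coe_mul, Subgroup.coe_div, Units.val_mul,
    Units.val_div_eq_div_val, hb, hb, hb]
  change cv (inclHom hTE s) (inclHom hTE t) = _
  rw [← hzval, hzst]
  have hps : p • β (θ s) = 0 := hβp _
  have hpt : p • β (θ t) = 0 := hβp _
  have hpst : p • β (θ (s * t)) = 0 := hβp _
  rw [div_mul_eq_mul_div, eq_div_iff (hm0' _), hm_sub _ _ (by rw [nsmul_add, hps, hpt, add_zero]) hpst,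
    hm_add _ _ hps hpt, mul_comm]

end Kill

end Literature.NumberTheory.GaloisRepresentations

end
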